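import Literature.NumberTheory.GaloisCohomology.Howard2004.TowerMorphism
import HarnessLib

/-!
# The residual propagated Selmer structure is the same at every level of a tower: H.5(b) reduces to one level
# (theorems only; no definition, no named fact, no instance)

Topic `NumberTheory/GaloisCohomology` (typed Howard 2004; companion of `SelmerTriples` §F (`IsQuotientBy.propagate`,
`propagateStructure`, `ResidualTau.thetaH1`, `H5b`), `TowerMorphism` (`cohomologyMap_one_oneCocycleClass`) and of the
cell's `DVRKolyvaginBound` (`SatisfiesH.h5b : ∀ k, H5b (T.ρ k) (h1 k).1 (A k) (t k).cond`)).

Howard's H.5(b) [arXiv 1202.6340 p. 7, L96–97] concerns ONE residual module `T̄ = T/𝔪T` with the condition `F̄`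
propagated from `T`.  In the level-wise typing the hypothesis is asked at every level `k` of the tower
`T^{(k)} = T/𝔪^{e_k}`, each with its own presentation `π̄_k : T^{(k)} ↠ T̄` and its own `θ_k`.  When the presentations
are compatible with the reductions (`π̄_k ∘ red = π̄_{k+1}`, the cell's `πbar_red`), the `θ`'s agree (`θ_eq`) and the
local conditions map onto each other (`cond_red`), the propagated structures COINCIDE, so all the clauses are the same:

* `cohomologyMap_one_comp_apply`, `cohomologyMap_one_congr_apply` — `H¹` of a composite / of pointwise-equal maps
  (cocycle level, degree one);
* **`IsQuotientBy.propagateStructure_eq_of_comp`** — for presentations `π′ : T′ ↠ T̄`, `π : T ↠ T̄` of the same `T̄`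
  and an equivariant additive `r : T′ → T` with `π′ = π ∘ r`, and Selmer structures with `H¹(r_v)(𝓕′_v) = 𝓕_v` at
  every place: `F̄′ = F̄` (`h′.propagateStructure 𝓕′ = h.propagateStructure 𝓕`);
* `ResidualTau.thetaH1_eq_of_forall_eq` — `θ_* ` depends only on the function `θ`;
* **`H5b_iff_of_comp`** — under the same hypotheses (+ `θ′ = θ` pointwise), `H5b` for `(T′, π̄′, θ′, 𝓕′)` iff `H5b`
  for `(T, π̄, θ, 𝓕)`.  For a `DVRSetting` with `πbar_red`, `θ_eq`, `cond_red` this makes `SatisfiesH.h5b` a statement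
  about level `0` alone (`H5b_zero_iff_forall` — induction along the tower).

References: [Howard2004HeegnerKolyvagin] H.5(b) (arXiv p. 7, L96–97), Def. 1.1.3 (propagation), §1.6 (the tower);
[SerreGaloisCohomology1997] I §2.2. BSD is not proved by any of this.
-/

noncomputable section

open Function Field IsDedekindDomain NumberField
open scoped NumberField ContRepresentation

namespace Literature.NumberTheory.GaloisCohomology.Howard2004

open Literature.NumberTheory.GaloisRepresentations
open Literature.NumberTheory.GaloisRepresentations.DiscreteGaloisModule (SelmerStructure)

/-! ## §1 `H¹` of composites and of pointwise-equal maps (degree one) -/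

section Maps

variable {F : Type} [Field F]
  {M₁ : Type} [AddCommGroup M₁] [TopologicalSpace M₁] [DiscreteTopology M₁]
  {M₂ : Type} [AddCommGroup M₂] [TopologicalSpace M₂] [DiscreteTopology M₂]
  {M₃ : Type} [AddCommGroup M₃] [TopologicalSpace M₃] [DiscreteTopology M₃]

/-- **`H¹(b) ∘ H¹(a) = H¹(c)` when `b ∘ a = c` pointwise** (equivariant additive maps of discrete modules; cocycle
level `[z] ↦ [b ∘ a ∘ z] = [c ∘ z]`). [cite: SerreGaloisCohomology1997, I §2.2] -/
theorem cohomologyMap_one_comp_apply (τ₁ : DiscreteGaloisModule F M₁) (τ₂ : DiscreteGaloisModule F M₂)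
    (τ₃ : DiscreteGaloisModule F M₃)
    (a : M₁ →+ M₂) (ha : ∀ (g : absoluteGaloisGroup F) (x : M₁), a (τ₁ g x) = τ₂ g (a x))
    (b : M₂ →+ M₃) (hb : ∀ (g : absoluteGaloisGroup F) (x : M₂), b (τ₂ g x) = τ₃ g (b x))
    (c : M₁ →+ M₃) (hc : ∀ (g : absoluteGaloisGroup F) (x : M₁), c (τ₁ g x) = τ₃ g (c x))
    (h : ∀ x, b (a x) = c x) (x : galoisCohomology τ₁ 1) :
    ContinuousRep.cohomologyMap τ₂ τ₃ b continuous_of_discreteTopology hb 1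
        (ContinuousRep.cohomologyMap τ₁ τ₂ a continuous_of_discreteTopology ha 1 x) =
      ContinuousRep.cohomologyMap τ₁ τ₃ c continuous_of_discreteTopology hc 1 x := by
  obtain ⟨z, rfl⟩ := oneCocycleClass_surjective τ₁.toTopRep x
  rw [cohomologyMap_one_oneCocycleClass, cohomologyMap_one_oneCocycleClass, cohomologyMap_one_oneCocycleClass]
  congr 1
  exact Subtype.ext (ContinuousMap.ext fun g ↦ h _)

/-- `H¹` of two pointwise-equal equivariant maps agree. [cite: SerreGaloisCohomology1997, I §2.2] -/
theorem cohomologyMap_one_congr_apply (τ₁ : DiscreteGaloisModule F M₁) (τ₂ : DiscreteGaloisModule F M₂)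
    (a a' : M₁ →+ M₂) (ha : ∀ (g : absoluteGaloisGroup F) (x : M₁), a (τ₁ g x) = τ₂ g (a x))
    (ha' : ∀ (g : absoluteGaloisGroup F) (x : M₁), a' (τ₁ g x) = τ₂ g (a' x)) (h : ∀ x, a x = a' x)
    (x : galoisCohomology τ₁ 1) :
    ContinuousRep.cohomologyMap τ₁ τ₂ a continuous_of_discreteTopology ha 1 x =
      ContinuousRep.cohomologyMap τ₁ τ₂ a' continuous_of_discreteTopology ha' 1 x := by
  obtain ⟨z, rfl⟩ := oneCocycleClass_surjective τ₁.toTopRep x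
  rw [cohomologyMap_one_oneCocycleClass, cohomologyMap_one_oneCocycleClass]
  congr 1
  exact Subtype.ext (ContinuousMap.ext fun g ↦ h _)

end Maps

/-! ## §2 Propagation along compatible presentations -/

section Propagate

variable {K : Type} [Field K] [NumberField K]
  {M : Type} [AddCommGroup M] [TopologicalSpace M] [DiscreteTopology M]
  {M' : Type} [AddCommGroup M'] [TopologicalSpace M'] [DiscreteTopology M']
  {R R' : Type} [CommRing R] [CommRing R'] [Module R M] [Module R' M']
  {Nbar : Type} [AddCommGroup Nbar] [TopologicalSpace Nbar] [DiscreteTopology Nbar] [Module R Nbar] [Module R' Nbar]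
  {ρ : DiscreteGaloisModule K M} {ρ' : DiscreteGaloisModule K M'} {ρbar : DiscreteGaloisModule K Nbar}
  {I : Ideal R} {I' : Ideal R'} {π : M →ₗ[R] Nbar} {π' : M' →ₗ[R'] Nbar}

/-- **`H¹(π̄′_v) = H¹(π̄_v) ∘ H¹(r_v)`** for presentations `π′ = π ∘ r` of the same residual module.
[cite: Howard2004HeegnerKolyvagin, Def. 1.1.3 (Quot(T) and propagation) and §1.6] -/
theorem IsQuotientBy.localCohomologyMap_one_eq_comp_apply (h' : IsQuotientBy ρ' I' ρbar π')
    (h : IsQuotientBy ρ I ρbar π) (r : M' →+ M)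
    (hr : ∀ (g : absoluteGaloisGroup K) (x : M'), r (ρ' g x) = ρ g (r x)) (hcomp : ∀ x, π' x = π (r x))
    (v : Place K) (y : galoisCohomology (ρ'.toLocal v) 1) :
    h'.localCohomologyMap v 1 y =
      h.localCohomologyMap v 1
        (ContinuousRep.cohomologyMap (ρ'.toLocal v) (ρ.toLocal v) r continuous_of_discreteTopology
          (fun _ x ↦ hr _ x) 1 y) :=
  (cohomologyMap_one_comp_apply (ρ'.toLocal v) (ρ.toLocal v) (ρbar.toLocal v) r (fun _ x ↦ hr _ x)
    π.toAddMonoidHom (fun _ m ↦ h.equivariant _ m) π'.toAddMonoidHom (fun _ m ↦ h'.equivariant _ m)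
    (fun x ↦ (hcomp x).symm) y).symm

/-- **The residual propagated structures of two compatible levels coincide**: if `π′ = π ∘ r` and `H¹(r_v)` maps
`𝓕′_v` ONTO `𝓕_v` at every place (`cond_red`), then `F̄′ = F̄`.
[cite: Howard2004HeegnerKolyvagin, Def. 1.1.3 and §1.6 (arXiv p. 12: F on T^{(k)} propagated from T)] -/
theorem IsQuotientBy.propagateStructure_eq_of_comp (h' : IsQuotientBy ρ' I' ρbar π')
    (h : IsQuotientBy ρ I ρbar π) (r : M' →+ M)
    (hr : ∀ (g : absoluteGaloisGroup K) (x : M'), r (ρ' g x) = ρ g (r x)) (hcomp : ∀ x, π' x = π (r x))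
    (𝓕' : SelmerStructure ρ') (𝓕 : SelmerStructure ρ)
    (hred : ∀ v : Place K, (𝓕' v).map
      (ContinuousRep.cohomologyMap (ρ'.toLocal v) (ρ.toLocal v) r continuous_of_discreteTopology
        (fun _ x ↦ hr _ x) 1) = 𝓕 v) :
    h'.propagateStructure 𝓕' = h.propagateStructure 𝓕 := by
  funext v
  rw [propagateStructure_apply, propagateStructure_apply]
  calc (𝓕' v).map (h'.localCohomologyMap v 1)
      = (𝓕' v).map ((h.localCohomologyMap v 1).comp
          (ContinuousRep.cohomologyMap (ρ'.toLocal v) (ρ.toLocal v) r continuous_of_discreteTopology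
            (fun _ x ↦ hr _ x) 1)) := by
        congr 1
        exact AddMonoidHom.ext fun y ↦ h'.localCohomologyMap_one_eq_comp_apply h r hr hcomp v y
    _ = ((𝓕' v).map (ContinuousRep.cohomologyMap (ρ'.toLocal v) (ρ.toLocal v) r continuous_of_discreteTopology
            (fun _ x ↦ hr _ x) 1)).map (h.localCohomologyMap v 1) := (AddSubgroup.map_map _ _ _).symm
    _ = (𝓕 v).map (h.localCohomologyMap v 1) := by rw [hred v]

end Propagate

/-! ## §3 H.5(b) is the same clause at every level -/

section H5b

variable {K : Type} [Field K] [NumberField K]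
  {M : Type} [AddCommGroup M] [TopologicalSpace M] [DiscreteTopology M]
  {M' : Type} [AddCommGroup M'] [TopologicalSpace M'] [DiscreteTopology M']
  {R R' : Type} [CommRing R] [CommRing R'] [IsLocalRing R] [IsLocalRing R'] [Module R M] [Module R' M']
  {cd : ConjugationDatum K}
  {Nbar : Type} [AddCommGroup Nbar] [TopologicalSpace Nbar] [DiscreteTopology Nbar] [Module R Nbar] [Module R' Nbar]
  {ρ : DiscreteGaloisModule K M} {ρ' : DiscreteGaloisModule K M'} {ρbar : DiscreteGaloisModule K Nbar}
  {π : M →ₗ[R] Nbar} {π' : M' →ₗ[R'] Nbar}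

omit [IsLocalRing R] [IsLocalRing R'] in
/-- `θ_*` on `H¹(K_v, ·)` depends only on the function `θ` (two `ResidualTau` data over different level rings with
the same `θ`, the cell's `θ_eq`). [cite: Howard2004HeegnerKolyvagin, H.5 (arXiv p. 7, L93–97)] -/
theorem ResidualTau.thetaH1_eq_of_forall_eq (A' : ResidualTau (R := R') cd ρbar) (A : ResidualTau (R := R) cd ρbar)
    (hθ : ∀ x, A'.θ x = A.θ x) (v : Place K) : A'.thetaH1 v = A.thetaH1 v :=
  AddMonoidHom.ext fun y ↦ cohomologyMap_one_congr_apply _ _ A'.θ.toAddMonoidHom A.θ.toAddMonoidHom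
    (fun _ x ↦ A'.compat _ x) (fun _ x ↦ A.compat _ x) hθ y

/-- **H.5(b) transfers between compatible levels.** Presentations `π̄′ : T′ ↠ T̄`, `π̄ : T ↠ T̄` of the same residual
module with `π̄′ = π̄ ∘ r` (`πbar_red`), `θ′ = θ` (`θ_eq`), and Selmer structures with `H¹(r_v)(𝓕′_v) = 𝓕_v` at every
place (`cond_red`): then `H5b` holds for `(T′, 𝓕′)` iff it holds for `(T, 𝓕)` (the propagated structures and the
maps `θ_* ∘ transport_v` are literally the same). [cite: Howard2004HeegnerKolyvagin, H.5(b) (arXiv p. 7, L96–97) and §1.6] -/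
theorem H5b_iff_of_comp (h' : IsQuotientBy ρ' (IsLocalRing.maximalIdeal R') ρbar π')
    (h : IsQuotientBy ρ (IsLocalRing.maximalIdeal R) ρbar π)
    (A' : ResidualTau (R := R') cd ρbar) (A : ResidualTau (R := R) cd ρbar) (hθ : ∀ x, A'.θ x = A.θ x)
    (r : M' →+ M) (hr : ∀ (g : absoluteGaloisGroup K) (x : M'), r (ρ' g x) = ρ g (r x))
    (hcomp : ∀ x, π' x = π (r x)) (𝓕' : SelmerStructure ρ') (𝓕 : SelmerStructure ρ)
    (hred : ∀ v : Place K, (𝓕' v).map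
      (ContinuousRep.cohomologyMap (ρ'.toLocal v) (ρ.toLocal v) r continuous_of_discreteTopology
        (fun _ x ↦ hr _ x) 1) = 𝓕 v) :
    H5b ρ' h' A' 𝓕' ↔ H5b ρ h A 𝓕 := by
  unfold H5b
  rw [h'.propagateStructure_eq_of_comp h r hr hcomp 𝓕' 𝓕 hred]
  refine forall_congr' fun v ↦ ?_
  rw [A'.thetaH1_eq_of_forall_eq A hθ]

end H5b

/-! ## §4 Along a tower: every level's clause is the level-`0` clause -/

section Tower

variable {K : Type} [Field K] [NumberField K]
  {N : ℕ → Type} [∀ k, AddCommGroup (N k)] [∀ k, TopologicalSpace (N k)] [∀ k, DiscreteTopology (N k)]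
  {Rk : ℕ → Type} [∀ k, CommRing (Rk k)] [∀ k, IsLocalRing (Rk k)] [∀ k, Module (Rk k) (N k)]
  {cd : ConjugationDatum K}
  {Nbar : Type} [AddCommGroup Nbar] [TopologicalSpace Nbar] [DiscreteTopology Nbar] [∀ k, Module (Rk k) Nbar]
  {ρ : ∀ k, DiscreteGaloisModule K (N k)} {ρbar : DiscreteGaloisModule K Nbar}
  {πbar : ∀ k, N k →ₗ[Rk k] Nbar}

/-- **`SatisfiesH.h5b` is a level-`0` statement**: along a tower with reductions `red_k : T^{(k+1)} → T^{(k)}`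
compatible with the residual presentations (`π̄_k ∘ red_k = π̄_{k+1}`), the `θ`'s (`θ_{k+1} = θ_k`) and the local
conditions (`H¹(red_{k,v})` maps the level-`k+1` condition ONTO the level-`k` one at every place), H.5(b) holds at every
level iff it holds at level `0`. [cite: Howard2004HeegnerKolyvagin, H.5(b) (arXiv p. 7, L96–97) and §1.6 (arXiv p. 12)] -/
theorem H5b_forall_iff_zero (hbar : ∀ k, IsQuotientBy (ρ k) (IsLocalRing.maximalIdeal (Rk k)) ρbar (πbar k))
    (A : ∀ k, ResidualTau (R := Rk k) cd ρbar) (hθ : ∀ k x, (A (k + 1)).θ x = (A k).θ x)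
    (red : ∀ k, N (k + 1) →+ N k)
    (hred_eq : ∀ k (g : absoluteGaloisGroup K) (x : N (k + 1)), red k (ρ (k + 1) g x) = ρ k g (red k x))
    (hπ : ∀ k x, πbar (k + 1) x = πbar k (red k x)) (𝓕 : ∀ k, SelmerStructure (ρ k))
    (hcond : ∀ k (v : Place K), (𝓕 (k + 1) v).map
      (ContinuousRep.cohomologyMap ((ρ (k + 1)).toLocal v) ((ρ k).toLocal v) (red k) continuous_of_discreteTopology
        (fun _ x ↦ hred_eq k _ x) 1) = 𝓕 k v) :
    (∀ k, H5b (ρ k) (hbar k) (A k) (𝓕 k)) ↔ H5b (ρ 0) (hbar 0) (A 0) (𝓕 0) := by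
  have step : ∀ k, H5b (ρ (k + 1)) (hbar (k + 1)) (A (k + 1)) (𝓕 (k + 1)) ↔ H5b (ρ k) (hbar k) (A k) (𝓕 k) :=
    fun k ↦ H5b_iff_of_comp (hbar (k + 1)) (hbar k) (A (k + 1)) (A k) (hθ k) (red k) (hred_eq k) (hπ k)
      (𝓕 (k + 1)) (𝓕 k) (hcond k)
  refine ⟨fun hall ↦ hall 0, fun h0 k ↦ ?_⟩
  induction k with
  | zero => exact h0
  | succ k ih => exact (step k).2 ih

end Tower

end Literature.NumberTheory.GaloisCohomology.Howard2004

end
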